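import Summits.QuantumFields.YangMills.Theorems.FluctuationComparisonRegPrIntLOrganTangentILawKerXOfScoreProfile
import HarnessLib

/-!
# Crux `FluctuationComparisonRegPrIntL` (stmt-QuantumFields-20520, rung R3), PATH-B organ, H-currency cone — (L48a) «KER′ OF THE (I-law-L)sq BLOCK BY THE REAL ROAD, DIFFERENCE
# FORM»: the kernel `kL` of the SQUARE organ FROM the second central moment kernel at the far corner-path × the MIXED-SCORE profile, PLUS the law-point INCREMENT of the
# covariance kernel along the `B′`-edge × the score profile (no calculus in `s′`; the a.e. `s` passes through; px5 g22 §81 (R-real))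

Cell `ym3-torus` (YM ladder rung R3 = continuum `SU(2)` Yang–Mills on the three-torus — a RUNG: NOT d = 4, NOT infinite volume, NOT a mass gap, NOT Clay).
Width seat `ym-ust-20520-w5` (gen 25), `--kind proof --supports stmt-QuantumFields-20520 --as helper`, count-neutral, DEFINITION-FREE, default heartbeats,
no registry ∕ binder ∕ `Lines/` edit.  Over ✓`…OrganTangentILawKerXOfScoreProfile` (`sub_mul_eq_integral_centred`), ✓`…RunpairOrganFibreLawDefs` (`wNum`).

WHY.  The KER′ half of the (I-law-L)sq block of row-sq v0.3 ∕ v0.4 (✓`…OrganTangentLawClausesOfILawAE` `hIlawL`, per `t`) lives on the relational SQUARE `X s s′`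
(`Y s = V00` moved by `expPt (s•m)` at `B`, `X s s′ = Y s` moved by `expPt (s′•m′)` at `B′`) and reads, at a.e. `s ∈ [0,1]`, with the FIXED observable `h := h_Ts∘Φ(V00, ·)`,
`Sc^{s′}_s := deriv_s wNum_t(X · s′) ∕ wNum_t(X s s′)` the score in the `m`-direction on the `s′`-path and `Cov^{s′}` the un-centred covariance under `Law_t(X s s′)`:
`|Cov¹(h, Sc¹_s) − Cov⁰(h, Sc⁰_s)| ≤ kL B B′·(‖m‖∕θc)·(‖m′‖∕θc)` — an `s′`-INCREMENT of a score covariance.  The real road takes the increment apart WITHOUT differentiating in `s′`: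
`Cov¹(h, Sc¹) − Cov⁰(h, Sc⁰) = Cov¹(h, Sc¹ − Sc⁰) + [Cov¹ − Cov⁰](h, Sc⁰)` (§0 `cov_sub_slot`, linearity in the second slot).  The first term is a second CENTRAL moment at the
law point `X s 1` (✓`sub_mul_eq_integral_centred`) of `h` (an `O(1)` profile `Kh`) against the MIXED score increment `Sc¹_s − Sc⁰_s` (second order: profile
`(‖m‖∕θc)(‖m′‖∕θc)·Q₂(·;B,B′)`, letter (SC-Δ-PROF) — print: second background derivatives of `Δ_k`, `V_n`, the Jacobian, [5] (3.155)–(3.156), [7] (174)–(181), [B12] p.267,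
and products of ramp slopes × per-level displacements); the second is the INCREMENT of the covariance functional of two FIXED profiled observables when the law point moves along the
`B′`-edge by `expPt m′` — letter (G₂-Δ^{prof}) with a three-index tree kernel `𝒢Δ(a,c;B′)` and the size `‖m′‖∕θc` (print: the `s′`-integrated third cumulant with the `s′`-score;
bottom §76 G2-b) — SOURCES of the shapes only.

WHAT.  §0 [folklore] `cov_sub_slot`; `kerIncrement_abs_le` (the two-term triangle packaged with the centring of the first term); `sizes_term₁_eq` ∕ `sizes_term₂_eq` (pull the two
sizes out); `rowMass_term₁_le` ∕ `rowMass_term₂_le` (κ-row masses of the two kernels from: `Kh`-contracted column mass of `𝒢`, the double mass of `Q₂`, the `Kh`-contracted edge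
mass of `𝒢Δ`, the column mass of `Q₁`, a two-factor triangle `ωc B B′ ≤ ωX c B·ωY c B′`).  §1 ★★`kerLClause_of_covKernel_increment_profiles` — ABSTRACT DOOR on the square frame
(`Fobs`, `Law`, `Sc : ℝ → (ℝ → G_j) → ℝ → Z → ℝ`, `Prof` indexed by the law point): (G₂^{prof}) at `X s 1` + (G₂-Δ^{prof}) along `X s 0 → X s 1` + (h-PROF) + (SC-PROF-L) +
(SC-Δ-PROF) + law facts `∀ᵐ s` (normalisation + 6 integrabilities at `X s 1`) + the masses ⟹ `∃ kL ≥ 0`, `t`-UNIFORM, κ-row mass `≤ NGh·N₂ + NΔ·Nrow ≤ M`, and the KER′(L) SHAPE with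
`kL B B′ := Σ_{a,c} Kh a·𝒢 a c·Q₂ c B B′ + Σ_{a,c} Kh a·𝒢Δ a c B′·Q₁ c B`.  §2 ★★`kerL_organ` — the ORGAN DOCK (`Fobs := h_Ts∘Φ`, `Law := wNum_t ∕ ∫wNum_t`,
`Sc t X′ s z := deriv (σ ↦ wNum_t (X′ σ) z) s ∕ wNum_t (X′ s) z`, `θc := θ_j∕4`): the KER′ conjunct text of `hIlawL` VERBATIM, for every `t ∈ [0,1]` with ONE kernel.

HONEST FRAMING: a door between HYPOTHESIS letters; (G₂^{prof}), (G₂-Δ^{prof}), (h-PROF), (SC-PROF-L), (SC-Δ-PROF) are exactly as OPEN as KER′(L) (bottom: §76 G2-b — volume-free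
tree decay of the tilted `m`-step fibre law's second and third cumulants); nothing of Bałaban's analysis is asserted or proved; REG′(L) is ✓p823910's `ilawRegSq_of_beta_of_incr`,
not touched; (I-curv), (I-cov), `OrganDischargeInputsHJ(sq)` ∕ `SpreadFibreLawH(J)(sq)` UNDISCHARGED; the five registered stubs of `Lines/semiclassical_s2beta.lean`, crux 20520
and `YM3TorusSU2` are NOT proved; registry untouched; rung R3 = SU(2) YM₃ on T³ — NOT d = 4, NOT infinite volume, NOT a mass gap, NOT Clay; the Yang–Mills mass gap is NOT
proved.  [folklore]
-/

set_option autoImplicit false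

noncomputable section

namespace Summit.QuantumFields.YangMills.Theorems.OrganTangentILawKerLOfScoreProfile

open MeasureTheory
open scoped BigOperators
open Literature.MathematicalPhysics.QuantumFieldTheory.Balaban1983to89 T3ContinuumYM3Torus T3NestedUnitLaws
  T3UnitLawDensityEML T4Continuum BalabanUVClass T3UnitScaleTilt T3LevelShift T3TiltDescent
open T4CubeChartExp (expPt)
open Summit.QuantumFields.YangMills.Theorems.OrganTangentILawKerXOfScoreProfile (sub_mul_eq_integral_centred)
open Summit.QuantumFields.YangMills.Theorems.FluctuationComparisonRegPrIntLRunpairOrganFibreLaw (wNum)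

/-! ## §0 Folklore: slot linearity, the increment triangle, sizes, row masses -/

section Folklore

variable {Z : Type*} [MeasurableSpace Z]

/-- Linearity of the un-centred covariance in its second slot. [folklore] -/
theorem cov_sub_slot (τ : Measure Z) (P R₁ R₀ L : Z → ℝ)
    (hPR₁ : Integrable (fun z => P z * R₁ z * L z) τ) (hPR₀ : Integrable (fun z => P z * R₀ z * L z) τ)
    (hR₁ : Integrable (fun z => R₁ z * L z) τ) (hR₀ : Integrable (fun z => R₀ z * L z) τ) :
    ((∫ z, P z * R₁ z * L z ∂τ) - (∫ z, P z * L z ∂τ) * (∫ z, R₁ z * L z ∂τ))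
        - ((∫ z, P z * R₀ z * L z ∂τ) - (∫ z, P z * L z ∂τ) * (∫ z, R₀ z * L z ∂τ))
      = (∫ z, P z * (R₁ z - R₀ z) * L z ∂τ) - (∫ z, P z * L z ∂τ) * (∫ z, (R₁ z - R₀ z) * L z ∂τ) := by
  have e1 : (∫ z, P z * (R₁ z - R₀ z) * L z ∂τ) = (∫ z, P z * R₁ z * L z ∂τ) - ∫ z, P z * R₀ z * L z ∂τ := by
    rw [← integral_sub hPR₁ hPR₀]; exact integral_congr_ae (ae_of_all _ fun z => by ring)
  have e2 : (∫ z, (R₁ z - R₀ z) * L z ∂τ) = (∫ z, R₁ z * L z ∂τ) - ∫ z, R₀ z * L z ∂τ := by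
    rw [← integral_sub hR₁ hR₀]; exact integral_congr_ae (ae_of_all _ fun z => by ring)
  rw [e1, e2]; ring

/-- **THE INCREMENT TRIANGLE**: `|Cov¹(P, R₁) − Cov⁰(P, R₀)| ≤ |∫ (P − cP)((R₁ − R₀) − cΔ)·L¹| + |Cov¹(P, R₀) − Cov⁰(P, R₀)|`, the first term CENTRED under `∫ L¹ = 1`. [folklore] -/
theorem kerIncrement_abs_le (τ : Measure Z) (P R₁ R₀ L₁ L₀ : Z → ℝ)
    (hL : Integrable L₁ τ) (hn : ∫ z, L₁ z ∂τ = 1) (hP : Integrable (fun z => P z * L₁ z) τ)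
    (hR₁ : Integrable (fun z => R₁ z * L₁ z) τ) (hR₀ : Integrable (fun z => R₀ z * L₁ z) τ)
    (hPR₁ : Integrable (fun z => P z * R₁ z * L₁ z) τ) (hPR₀ : Integrable (fun z => P z * R₀ z * L₁ z) τ)
    {T₁ T₂ : ℝ}
    (h₁ : |∫ z, (P z - ∫ z', P z' * L₁ z' ∂τ) * ((R₁ z - R₀ z) - ∫ z', (R₁ z' - R₀ z') * L₁ z' ∂τ) * L₁ z ∂τ| ≤ T₁)
    (h₂ : |((∫ z, P z * R₀ z * L₁ z ∂τ) - (∫ z, P z * L₁ z ∂τ) * (∫ z, R₀ z * L₁ z ∂τ))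
            - ((∫ z, P z * R₀ z * L₀ z ∂τ) - (∫ z, P z * L₀ z ∂τ) * (∫ z, R₀ z * L₀ z ∂τ))| ≤ T₂) :
    |((∫ z, P z * R₁ z * L₁ z ∂τ) - (∫ z, P z * L₁ z ∂τ) * (∫ z, R₁ z * L₁ z ∂τ))
        - ((∫ z, P z * R₀ z * L₀ z ∂τ) - (∫ z, P z * L₀ z ∂τ) * (∫ z, R₀ z * L₀ z ∂τ))| ≤ T₁ + T₂ := by
  have hΔ : Integrable (fun z => (R₁ z - R₀ z) * L₁ z) τ := (hR₁.sub hR₀).congr (ae_of_all _ fun z => by simp only [Pi.sub_apply]; ring)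
  have hPΔ : Integrable (fun z => P z * (R₁ z - R₀ z) * L₁ z) τ := (hPR₁.sub hPR₀).congr (ae_of_all _ fun z => by simp only [Pi.sub_apply]; ring)
  refine (abs_sub_le _ ((∫ z, P z * R₀ z * L₁ z ∂τ) - (∫ z, P z * L₁ z ∂τ) * (∫ z, R₀ z * L₁ z ∂τ)) _).trans (add_le_add ?_ h₂)
  rw [cov_sub_slot τ P R₁ R₀ L₁ hPR₁ hPR₀ hR₁ hR₀, sub_mul_eq_integral_centred τ P (fun z => R₁ z - R₀ z) L₁ hL hn hP hΔ hPΔ]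
  exact h₁

variable {ι ιc : Type*} [Fintype ι] [Fintype ιc]

omit [Fintype ιc] in
/-- Sizes out of the first term: `Σ_{a,c} |Kh a|·𝒢 a c·|s·s′·Q₂ c B B′| = (Σ_{a,c} Kh a·𝒢 a c·Q₂ c B B′)·s·s′`. [folklore] -/
theorem sizes_term₁_eq (Kh : ι → ℝ) (𝒢 : ι → ι → ℝ) (Q₂ : ι → ιc → ιc → ℝ) (hKh : ∀ a, 0 ≤ Kh a) (hQ₂ : ∀ c B B', 0 ≤ Q₂ c B B')
    (B B' : ιc) {s s' : ℝ} (hs : 0 ≤ s) (hs' : 0 ≤ s') :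
    ∑ a, ∑ c, |Kh a| * 𝒢 a c * |s * s' * Q₂ c B B'| = (∑ a, ∑ c, Kh a * 𝒢 a c * Q₂ c B B') * s * s' := by
  rw [Finset.sum_mul, Finset.sum_mul]
  refine Finset.sum_congr rfl fun a _ => ?_
  rw [Finset.sum_mul, Finset.sum_mul]
  refine Finset.sum_congr rfl fun c _ => ?_
  rw [abs_of_nonneg (hKh a), abs_of_nonneg (mul_nonneg (mul_nonneg hs hs') (hQ₂ c B B'))]
  ring

omit [Fintype ιc] in
/-- Sizes out of the second term: `s′·Σ_{a,c} |Kh a|·𝒢Δ a c B′·|s·Q₁ c B| = (Σ_{a,c} Kh a·𝒢Δ a c B′·Q₁ c B)·s·s′`. [folklore] -/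
theorem sizes_term₂_eq (Kh : ι → ℝ) (𝒢Δ : ι → ι → ιc → ℝ) (Q₁ : ι → ιc → ℝ) (hKh : ∀ a, 0 ≤ Kh a) (hQ₁ : ∀ c B, 0 ≤ Q₁ c B)
    (B B' : ιc) {s s' : ℝ} (hs : 0 ≤ s) :
    s' * ∑ a, ∑ c, |Kh a| * 𝒢Δ a c B' * |s * Q₁ c B| = (∑ a, ∑ c, Kh a * 𝒢Δ a c B' * Q₁ c B) * s * s' := by
  rw [Finset.mul_sum, Finset.sum_mul, Finset.sum_mul]
  refine Finset.sum_congr rfl fun a _ => ?_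
  rw [Finset.mul_sum, Finset.sum_mul, Finset.sum_mul]
  refine Finset.sum_congr rfl fun c _ => ?_
  rw [abs_of_nonneg (hKh a), abs_of_nonneg (mul_nonneg hs (hQ₁ c B))]
  ring

/-- κ-row mass of the first kernel: `Kh`-contracted column mass of `𝒢` (uniform in the column) × the DOUBLE mass of the mixed-score profile. [folklore] -/
theorem rowMass_term₁_le (Kh : ι → ℝ) (𝒢 : ι → ι → ℝ) (Q₂ : ι → ιc → ιc → ℝ) (ωc : ιc → ιc → ℝ)
    (hQ₂ : ∀ c B B', 0 ≤ Q₂ c B B') (hωc : ∀ B B', 0 ≤ ωc B B')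
    {NGh N₂ : ℝ} (hNGh : 0 ≤ NGh) (hGh : ∀ c, ∑ a, Kh a * 𝒢 a c ≤ NGh) (B : ιc) (hQ2 : ∑ c, ∑ B', Q₂ c B B' * ωc B B' ≤ N₂) :
    ∑ B', (∑ a, ∑ c, Kh a * 𝒢 a c * Q₂ c B B') * ωc B B' ≤ NGh * N₂ := by
  have e : ∀ B', (∑ a, ∑ c, Kh a * 𝒢 a c * Q₂ c B B') * ωc B B' = ∑ c, (∑ a, Kh a * 𝒢 a c) * (Q₂ c B B' * ωc B B') := by
    intro B'
    rw [Finset.sum_comm, Finset.sum_mul]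
    refine Finset.sum_congr rfl fun c _ => ?_
    rw [Finset.sum_mul, Finset.sum_mul]
    exact Finset.sum_congr rfl fun a _ => by ring
  calc ∑ B', (∑ a, ∑ c, Kh a * 𝒢 a c * Q₂ c B B') * ωc B B'
      = ∑ B', ∑ c, (∑ a, Kh a * 𝒢 a c) * (Q₂ c B B' * ωc B B') := Finset.sum_congr rfl fun B' _ => e B'
    _ ≤ ∑ B', ∑ c, NGh * (Q₂ c B B' * ωc B B') :=
        Finset.sum_le_sum fun B' _ => Finset.sum_le_sum fun c _ => mul_le_mul_of_nonneg_right (hGh c) (mul_nonneg (hQ₂ c B B') (hωc B B'))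
    _ = NGh * ∑ c, ∑ B', Q₂ c B B' * ωc B B' := by rw [Finset.sum_comm, Finset.mul_sum]; exact Finset.sum_congr rfl fun c _ => by rw [Finset.mul_sum]
    _ ≤ NGh * N₂ := mul_le_mul_of_nonneg_left hQ2 hNGh

/-- κ-row mass of the second kernel: two-factor triangle, `Kh`-contracted EDGE mass of `𝒢Δ` (uniform in the column) × the column mass of the score profile. [folklore] -/
theorem rowMass_term₂_le (Kh : ι → ℝ) (𝒢Δ : ι → ι → ιc → ℝ) (Q₁ : ι → ιc → ℝ) (ωc : ιc → ιc → ℝ) (ωX ωY : ι → ιc → ℝ)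
    (hKh : ∀ a, 0 ≤ Kh a) (hGΔ0 : ∀ a c B', 0 ≤ 𝒢Δ a c B') (hQ₁ : ∀ c B, 0 ≤ Q₁ c B) (hωX : ∀ c B, 0 ≤ ωX c B)
    (htri : ∀ B B' c, ωc B B' ≤ ωX c B * ωY c B')
    {NΔ Nrow : ℝ} (hNΔ : 0 ≤ NΔ) (hGΔ : ∀ c, ∑ B', (∑ a, Kh a * 𝒢Δ a c B') * ωY c B' ≤ NΔ) (B : ιc) (hQcol : ∑ c, Q₁ c B * ωX c B ≤ Nrow) :
    ∑ B', (∑ a, ∑ c, Kh a * 𝒢Δ a c B' * Q₁ c B) * ωc B B' ≤ NΔ * Nrow := by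
  have hS0 : ∀ c B', 0 ≤ ∑ a, Kh a * 𝒢Δ a c B' := fun c B' => Finset.sum_nonneg fun a _ => mul_nonneg (hKh a) (hGΔ0 a c B')
  have e : ∀ B', (∑ a, ∑ c, Kh a * 𝒢Δ a c B' * Q₁ c B) * ωc B B' = ∑ c, (∑ a, Kh a * 𝒢Δ a c B') * Q₁ c B * ωc B B' := by
    intro B'
    rw [Finset.sum_comm, Finset.sum_mul]
    refine Finset.sum_congr rfl fun c _ => ?_
    rw [Finset.sum_mul, Finset.sum_mul, Finset.sum_mul]
  calc ∑ B', (∑ a, ∑ c, Kh a * 𝒢Δ a c B' * Q₁ c B) * ωc B B'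
      = ∑ B', ∑ c, (∑ a, Kh a * 𝒢Δ a c B') * Q₁ c B * ωc B B' := Finset.sum_congr rfl fun B' _ => e B'
    _ ≤ ∑ B', ∑ c, (∑ a, Kh a * 𝒢Δ a c B') * Q₁ c B * (ωX c B * ωY c B') :=
        Finset.sum_le_sum fun B' _ => Finset.sum_le_sum fun c _ =>
          mul_le_mul_of_nonneg_left (htri B B' c) (mul_nonneg (hS0 c B') (hQ₁ c B))
    _ = ∑ c, (Q₁ c B * ωX c B) * ∑ B', (∑ a, Kh a * 𝒢Δ a c B') * ωY c B' := by
        rw [Finset.sum_comm]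
        refine Finset.sum_congr rfl fun c _ => ?_
        rw [Finset.mul_sum]
        exact Finset.sum_congr rfl fun B' _ => by ring
    _ ≤ ∑ c, (Q₁ c B * ωX c B) * NΔ := Finset.sum_le_sum fun c _ => mul_le_mul_of_nonneg_left (hGΔ c) (mul_nonneg (hQ₁ c B) (hωX c B))
    _ = (∑ c, Q₁ c B * ωX c B) * NΔ := by rw [Finset.sum_mul]
    _ ≤ Nrow * NΔ := mul_le_mul_of_nonneg_right hQcol hNΔ
    _ = NΔ * Nrow := mul_comm _ _

end Folklore

/-! ## §1 The abstract door on the square frame -/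

section Abstract

variable {P : Params} {j : ℕ} {ι : Type*} [Fintype ι] {Z : Type*} [MeasurableSpace Z]

/-- ★★ **KER′ OF THE (I-law-L)sq BLOCK ⟸ (G₂^{prof}) × (G₂-Δ^{prof}) × (h-PROF) × (SC-PROF-L) × (SC-Δ-PROF)** — abstract currency on the relational square; see the module
docstring. [folklore] -/
theorem kerLClause_of_covKernel_increment_profiles (τ : Measure Z) (Fobs : GaugeField P j ↥(Matrix.specialUnitaryGroup (Fin 2) ℂ) → Z → ℝ)
    (Law : ℝ → GaugeField P j ↥(Matrix.specialUnitaryGroup (Fin 2) ℂ) → Z → ℝ)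
    (Sc : ℝ → (ℝ → GaugeField P j ↥(Matrix.specialUnitaryGroup (Fin 2) ℂ)) → ℝ → Z → ℝ)
    (θc rc κ M : ℝ) (hθc : 0 < θc)
    (Prof : GaugeField P j ↥(Matrix.specialUnitaryGroup (Fin 2) ℂ) → (Z → ℝ) → (ι → ℝ) → Prop)
    -- (G₂^{prof}) the second central moment kernel at the FAR corner-path law points `X s 1`; `Kh`-contracted column mass
    (𝒢 : ι → ι → ℝ) (Kh : ι → ℝ) (NGh : ℝ) (hG0 : ∀ a c, 0 ≤ 𝒢 a c) (hKh0 : ∀ a, 0 ≤ Kh a) (hNGh : 0 ≤ NGh) (hGh : ∀ c, ∑ a, Kh a * 𝒢 a c ≤ NGh)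
    (hCov : ∀ t : ℝ, 0 ≤ t → t ≤ 1 → ∀ (B B' : PBond P j) (m m' : Fin 3 → ℝ) (V00 V10 V01 V11 : GaugeField P j ↥(Matrix.specialUnitaryGroup (Fin 2) ℂ)),
      ‖m‖ ≤ rc * θc → ‖m'‖ ≤ rc * θc → PlaqSmall θc V00 → PlaqSmall θc V10 → PlaqSmall θc V01 → PlaqSmall θc V11 →
      (∀ e, e ≠ B → V10 e = V00 e) → V10 B = V00 B * expPt m → (∀ e, e ≠ B' → V01 e = V00 e) → V01 B' = V00 B' * expPt m' →
      (∀ e, e ≠ B' → V11 e = V10 e) → V11 B' = V10 B' * expPt m' →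
      ∀ (Y : ℝ → GaugeField P j ↥(Matrix.specialUnitaryGroup (Fin 2) ℂ)) (X : ℝ → ℝ → GaugeField P j ↥(Matrix.specialUnitaryGroup (Fin 2) ℂ)),
      (∀ s e, e ≠ B → Y s e = V00 e) → (∀ s, Y s B = V00 B * expPt (s • m)) → (∀ s s' e, e ≠ B' → X s s' e = Y s e) → (∀ s s', X s s' B' = Y s B' * expPt (s' • m')) →
      ∀ s ∈ Set.Icc (0:ℝ) 1, ∀ (Pf Qf : Z → ℝ) (p q : ι → ℝ), Prof (X s 1) Pf p → Prof (X s 1) Qf q → ∀ (cP cQ : ℝ),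
        cP = ∫ z, Pf z * Law t (X s 1) z ∂τ → cQ = ∫ z, Qf z * Law t (X s 1) z ∂τ →
          Integrable (fun z => (Pf z - cP) * (Qf z - cQ) * Law t (X s 1) z) τ ∧
            |∫ z, (Pf z - cP) * (Qf z - cQ) * Law t (X s 1) z ∂τ| ≤ ∑ a, ∑ c, |p a| * 𝒢 a c * |q c|)
    -- (G₂-Δ^{prof}) the INCREMENT of the un-centred covariance of two FIXED profiled observables along the `B′`-edge `X s 0 → X s 1`; `Kh`-contracted edge mass
    (𝒢Δ : ι → ι → PBond P j → ℝ) (ωY : ι → PBond P j → ℝ) (NΔ : ℝ) (hGΔ0 : ∀ a c B', 0 ≤ 𝒢Δ a c B') (hNΔ : 0 ≤ NΔ)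
    (hGΔ : ∀ c, ∑ B', (∑ a, Kh a * 𝒢Δ a c B') * ωY c B' ≤ NΔ)
    (hIncr : ∀ t : ℝ, 0 ≤ t → t ≤ 1 → ∀ (B B' : PBond P j) (m m' : Fin 3 → ℝ) (V00 V10 V01 V11 : GaugeField P j ↥(Matrix.specialUnitaryGroup (Fin 2) ℂ)),
      ‖m‖ ≤ rc * θc → ‖m'‖ ≤ rc * θc → PlaqSmall θc V00 → PlaqSmall θc V10 → PlaqSmall θc V01 → PlaqSmall θc V11 →
      (∀ e, e ≠ B → V10 e = V00 e) → V10 B = V00 B * expPt m → (∀ e, e ≠ B' → V01 e = V00 e) → V01 B' = V00 B' * expPt m' →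
      (∀ e, e ≠ B' → V11 e = V10 e) → V11 B' = V10 B' * expPt m' →
      ∀ (Y : ℝ → GaugeField P j ↥(Matrix.specialUnitaryGroup (Fin 2) ℂ)) (X : ℝ → ℝ → GaugeField P j ↥(Matrix.specialUnitaryGroup (Fin 2) ℂ)),
      (∀ s e, e ≠ B → Y s e = V00 e) → (∀ s, Y s B = V00 B * expPt (s • m)) → (∀ s s' e, e ≠ B' → X s s' e = Y s e) → (∀ s s', X s s' B' = Y s B' * expPt (s' • m')) →
      ∀ s ∈ Set.Icc (0:ℝ) 1, ∀ (Pf Qf : Z → ℝ) (p q : ι → ℝ), Prof (X s 0) Pf p → Prof (X s 0) Qf q →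
        |((∫ z, Pf z * Qf z * Law t (X s 1) z ∂τ) - (∫ z, Pf z * Law t (X s 1) z ∂τ) * (∫ z, Qf z * Law t (X s 1) z ∂τ))
            - ((∫ z, Pf z * Qf z * Law t (X s 0) z ∂τ) - (∫ z, Pf z * Law t (X s 0) z ∂τ) * (∫ z, Qf z * Law t (X s 0) z ∂τ))|
          ≤ ‖m'‖ / θc * ∑ a, ∑ c, |p a| * 𝒢Δ a c B' * |q c|)
    -- (SC-PROF-L) ∕ (SC-Δ-PROF): profiles of the score on the near path and of the MIXED score increment; masses
    (Q₁ : ι → PBond P j → ℝ) (Q₂ : ι → PBond P j → PBond P j → ℝ) (ωX : ι → PBond P j → ℝ) (Nrow N₂ : ℝ)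
    (hQ10 : ∀ c B, 0 ≤ Q₁ c B) (hQ20 : ∀ c B B', 0 ≤ Q₂ c B B') (hωX : ∀ c B, 0 ≤ ωX c B)
    (hQcol : ∀ B, ∑ c, Q₁ c B * ωX c B ≤ Nrow) (hQ2 : ∀ B, ∑ c, ∑ B', Q₂ c B B' * Real.exp (κ * (B.src.tdist B'.src : ℝ)) ≤ N₂)
    (htri : ∀ (B B' : PBond P j) (c : ι), Real.exp (κ * (B.src.tdist B'.src : ℝ)) ≤ ωX c B * ωY c B')
    -- (h-PROF) ∧ (SC-PROF-L) ∧ (SC-Δ-PROF) at the square law points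
    (hProfF : ∀ t : ℝ, 0 ≤ t → t ≤ 1 → ∀ (B B' : PBond P j) (m m' : Fin 3 → ℝ) (V00 V10 V01 V11 : GaugeField P j ↥(Matrix.specialUnitaryGroup (Fin 2) ℂ)),
      ‖m‖ ≤ rc * θc → ‖m'‖ ≤ rc * θc → PlaqSmall θc V00 → PlaqSmall θc V10 → PlaqSmall θc V01 → PlaqSmall θc V11 →
      (∀ e, e ≠ B → V10 e = V00 e) → V10 B = V00 B * expPt m → (∀ e, e ≠ B' → V01 e = V00 e) → V01 B' = V00 B' * expPt m' →
      (∀ e, e ≠ B' → V11 e = V10 e) → V11 B' = V10 B' * expPt m' →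
      ∀ (Y : ℝ → GaugeField P j ↥(Matrix.specialUnitaryGroup (Fin 2) ℂ)) (X : ℝ → ℝ → GaugeField P j ↥(Matrix.specialUnitaryGroup (Fin 2) ℂ)),
      (∀ s e, e ≠ B → Y s e = V00 e) → (∀ s, Y s B = V00 B * expPt (s • m)) → (∀ s s' e, e ≠ B' → X s s' e = Y s e) → (∀ s s', X s s' B' = Y s B' * expPt (s' • m')) →
      ∀ s ∈ Set.Icc (0:ℝ) 1,
        Prof (X s 1) (Fobs V00) Kh ∧ Prof (X s 0) (Fobs V00) Kh ∧ Prof (X s 0) (Sc t (fun σ => X σ 0) s) (fun a => ‖m‖ / θc * Q₁ a B) ∧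
          Prof (X s 1) (fun z => Sc t (fun σ => X σ 1) s z - Sc t (fun σ => X σ 0) s z) (fun a => ‖m‖ / θc * (‖m'‖ / θc) * Q₂ a B B'))
    -- the law facts at the far corner-path law points, a.e. in the path parameter
    (hlaw : ∀ t : ℝ, 0 ≤ t → t ≤ 1 → ∀ (B B' : PBond P j) (m m' : Fin 3 → ℝ) (V00 V10 V01 V11 : GaugeField P j ↥(Matrix.specialUnitaryGroup (Fin 2) ℂ)),
      ‖m‖ ≤ rc * θc → ‖m'‖ ≤ rc * θc → PlaqSmall θc V00 → PlaqSmall θc V10 → PlaqSmall θc V01 → PlaqSmall θc V11 →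
      (∀ e, e ≠ B → V10 e = V00 e) → V10 B = V00 B * expPt m → (∀ e, e ≠ B' → V01 e = V00 e) → V01 B' = V00 B' * expPt m' →
      (∀ e, e ≠ B' → V11 e = V10 e) → V11 B' = V10 B' * expPt m' →
      ∀ (Y : ℝ → GaugeField P j ↥(Matrix.specialUnitaryGroup (Fin 2) ℂ)) (X : ℝ → ℝ → GaugeField P j ↥(Matrix.specialUnitaryGroup (Fin 2) ℂ)),
      (∀ s e, e ≠ B → Y s e = V00 e) → (∀ s, Y s B = V00 B * expPt (s • m)) → (∀ s s' e, e ≠ B' → X s s' e = Y s e) → (∀ s s', X s s' B' = Y s B' * expPt (s' • m')) →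
      ∀ᵐ s ∂(volume : Measure ℝ), s ∈ Set.Icc (0:ℝ) 1 →
        Integrable (fun z => Law t (X s 1) z) τ ∧ ∫ z, Law t (X s 1) z ∂τ = 1 ∧ Integrable (fun z => Fobs V00 z * Law t (X s 1) z) τ ∧
        Integrable (fun z => Sc t (fun σ => X σ 1) s z * Law t (X s 1) z) τ ∧ Integrable (fun z => Sc t (fun σ => X σ 0) s z * Law t (X s 1) z) τ ∧
        Integrable (fun z => Fobs V00 z * Sc t (fun σ => X σ 1) s z * Law t (X s 1) z) τ ∧
        Integrable (fun z => Fobs V00 z * Sc t (fun σ => X σ 0) s z * Law t (X s 1) z) τ)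
    (hM : NGh * N₂ + NΔ * Nrow ≤ M) :
    ∃ kL : PBond P j → PBond P j → ℝ, (∀ B B', 0 ≤ kL B B') ∧
      (∀ B, ∑ B', kL B B' * Real.exp (κ * (B.src.tdist B'.src : ℝ)) ≤ M) ∧
      ∀ t : ℝ, 0 ≤ t → t ≤ 1 → ∀ (B B' : PBond P j) (m m' : Fin 3 → ℝ) (V00 V10 V01 V11 : GaugeField P j ↥(Matrix.specialUnitaryGroup (Fin 2) ℂ)),
        ‖m‖ ≤ rc * θc → ‖m'‖ ≤ rc * θc → PlaqSmall θc V00 → PlaqSmall θc V10 → PlaqSmall θc V01 → PlaqSmall θc V11 →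
        (∀ e, e ≠ B → V10 e = V00 e) → V10 B = V00 B * expPt m → (∀ e, e ≠ B' → V01 e = V00 e) → V01 B' = V00 B' * expPt m' →
        (∀ e, e ≠ B' → V11 e = V10 e) → V11 B' = V10 B' * expPt m' →
        ∀ (Y : ℝ → GaugeField P j ↥(Matrix.specialUnitaryGroup (Fin 2) ℂ)) (X : ℝ → ℝ → GaugeField P j ↥(Matrix.specialUnitaryGroup (Fin 2) ℂ)),
        (∀ s e, e ≠ B → Y s e = V00 e) → (∀ s, Y s B = V00 B * expPt (s • m)) → (∀ s s' e, e ≠ B' → X s s' e = Y s e) → (∀ s s', X s s' B' = Y s B' * expPt (s' • m')) →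
        ∀ᵐ s ∂(volume : Measure ℝ), s ∈ Set.Icc (0:ℝ) 1 →
          |((∫ z, Fobs V00 z * Sc t (fun σ => X σ 1) s z * Law t (X s 1) z ∂τ)
                - (∫ z, Fobs V00 z * Law t (X s 1) z ∂τ) * (∫ z, Sc t (fun σ => X σ 1) s z * Law t (X s 1) z ∂τ))
              - ((∫ z, Fobs V00 z * Sc t (fun σ => X σ 0) s z * Law t (X s 0) z ∂τ)
                - (∫ z, Fobs V00 z * Law t (X s 0) z ∂τ) * (∫ z, Sc t (fun σ => X σ 0) s z * Law t (X s 0) z ∂τ))|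
            ≤ kL B B' * (‖m‖ / θc) * (‖m'‖ / θc) := by
  refine ⟨fun B B' => (∑ a, ∑ c, Kh a * 𝒢 a c * Q₂ c B B') + ∑ a, ∑ c, Kh a * 𝒢Δ a c B' * Q₁ c B, fun B B' => ?_, fun B => ?_, ?_⟩
  · exact add_nonneg (Finset.sum_nonneg fun a _ => Finset.sum_nonneg fun c _ => mul_nonneg (mul_nonneg (hKh0 a) (hG0 a c)) (hQ20 c B B'))
      (Finset.sum_nonneg fun a _ => Finset.sum_nonneg fun c _ => mul_nonneg (mul_nonneg (hKh0 a) (hGΔ0 a c B')) (hQ10 c B))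
  · calc ∑ B', ((∑ a, ∑ c, Kh a * 𝒢 a c * Q₂ c B B') + ∑ a, ∑ c, Kh a * 𝒢Δ a c B' * Q₁ c B) * Real.exp (κ * (B.src.tdist B'.src : ℝ))
        = (∑ B', (∑ a, ∑ c, Kh a * 𝒢 a c * Q₂ c B B') * Real.exp (κ * (B.src.tdist B'.src : ℝ)))
            + ∑ B', (∑ a, ∑ c, Kh a * 𝒢Δ a c B' * Q₁ c B) * Real.exp (κ * (B.src.tdist B'.src : ℝ)) := by
          rw [← Finset.sum_add_distrib]; exact Finset.sum_congr rfl fun B' _ => add_mul _ _ _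
      _ ≤ NGh * N₂ + NΔ * Nrow :=
          add_le_add (rowMass_term₁_le Kh 𝒢 Q₂ (fun B B' => Real.exp (κ * (B.src.tdist B'.src : ℝ))) hQ20 (fun B B' => (Real.exp_pos _).le) hNGh hGh B (hQ2 B))
            (rowMass_term₂_le Kh 𝒢Δ Q₁ (fun B B' => Real.exp (κ * (B.src.tdist B'.src : ℝ))) ωX ωY hKh0 hGΔ0 hQ10 hωX (fun B B' c => htri B B' c)
              hNΔ hGΔ B (hQcol B))
      _ ≤ M := hM
  · intro t ht0 ht1 B B' m m' V00 V10 V01 V11 hm hm' h00 h10 h01 h11 h10off h10on h01off h01on h11off h11on Y X hYoff hYon hXoff hXon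
    filter_upwards [hlaw t ht0 ht1 B B' m m' V00 V10 V01 V11 hm hm' h00 h10 h01 h11 h10off h10on h01off h01on h11off h11on Y X hYoff hYon hXoff hXon]
      with s hs hsI
    obtain ⟨hLi, hLn, hFi, hS1i, hS0i, hFS1i, hFS0i⟩ := hs hsI
    obtain ⟨hpF1, hpF0, hq0, hqΔ⟩ :=
      hProfF t ht0 ht1 B B' m m' V00 V10 V01 V11 hm hm' h00 h10 h01 h11 h10off h10on h01off h01on h11off h11on Y X hYoff hYon hXoff hXon s hsI
    obtain ⟨-, hbd1⟩ := hCov t ht0 ht1 B B' m m' V00 V10 V01 V11 hm hm' h00 h10 h01 h11 h10off h10on h01off h01on h11off h11on Y X hYoff hYon hXoff hXon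
      s hsI _ _ _ _ hpF1 hqΔ _ _ rfl rfl
    have hbd2 := hIncr t ht0 ht1 B B' m m' V00 V10 V01 V11 hm hm' h00 h10 h01 h11 h10off h10on h01off h01on h11off h11on Y X hYoff hYon hXoff hXon
      s hsI _ _ _ _ hpF0 hq0
    have hs0 : 0 ≤ ‖m‖ / θc := div_nonneg (norm_nonneg _) hθc.le
    have hs0' : 0 ≤ ‖m'‖ / θc := div_nonneg (norm_nonneg _) hθc.le
    have key := kerIncrement_abs_le τ (Fobs V00) (Sc t (fun σ => X σ 1) s) (Sc t (fun σ => X σ 0) s) (Law t (X s 1)) (Law t (X s 0))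
      hLi hLn hFi hS1i hS0i hFS1i hFS0i
      (T₁ := ∑ a, ∑ c, |Kh a| * 𝒢 a c * |‖m‖ / θc * (‖m'‖ / θc) * Q₂ c B B'|)
      (T₂ := ‖m'‖ / θc * ∑ a, ∑ c, |Kh a| * 𝒢Δ a c B' * |‖m‖ / θc * Q₁ c B|) hbd1 hbd2
    refine key.trans (le_of_eq ?_)
    rw [sizes_term₁_eq Kh 𝒢 Q₂ hKh0 hQ20 B B' hs0 hs0', sizes_term₂_eq Kh 𝒢Δ Q₁ hKh0 hQ10 B B' hs0]
    ring

end Abstract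

/-! ## §2 The organ dock: ✓p821651's `hIlawL` KER′ conjunct text -/

section Organ

variable {ι : Type*} [Fintype ι]

/-- ★★ **THE ORGAN READING OF §1** — `Fobs := h_Ts∘Φ`, `Law t Xw z := wNum_t Xw z ∕ ∫ wNum_t Xw`, `Sc t X′ s z := deriv (σ ↦ wNum_t (X′ σ) z) s ∕ wNum_t (X′ s) z`,
`θc := θ_j∕4`: the KER′ conjunct of the (I-law-L)sq block VERBATIM, for every `t ∈ [0,1]` with ONE kernel (✓p821651's `hIlawL` is per `t`; specialise). To be paired with
✓p823910's REG′ `ilawRegSq_of_beta_of_incr`. [folklore] -/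
theorem kerL_organ (F : T3Family) (γ b₀ p₀ : ℝ) (j Ts : ℕ)
    (ρ ρ' : (i : ℕ) → GaugeField (F.P i) 0 ↥(Matrix.specialUnitaryGroup (Fin 2) ℂ) → ℝ) {Z : Type} [MeasurableSpace Z] (τ : Measure Z)
    (Φ : GaugeField (F.P j) 0 ↥(Matrix.specialUnitaryGroup (Fin 2) ℂ) × Z → GaugeField (F.P Ts) 0 ↥(Matrix.specialUnitaryGroup (Fin 2) ℂ))
    (J : GaugeField (F.P j) 0 ↥(Matrix.specialUnitaryGroup (Fin 2) ℂ) × Z → NNReal)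
    (rc κ M : ℝ) (hθ : 0 < θBal F.L γ b₀ p₀ j)
    (Prof : GaugeField (F.P j) 0 ↥(Matrix.specialUnitaryGroup (Fin 2) ℂ) → (Z → ℝ) → (ι → ℝ) → Prop)
    -- (G₂^{prof}) the second central moment kernel at the FAR corner-path law points `X s 1`; `Kh`-contracted column mass
    (𝒢 : ι → ι → ℝ) (Kh : ι → ℝ) (NGh : ℝ) (hG0 : ∀ a c, 0 ≤ 𝒢 a c) (hKh0 : ∀ a, 0 ≤ Kh a) (hNGh : 0 ≤ NGh) (hGh : ∀ c, ∑ a, Kh a * 𝒢 a c ≤ NGh)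
    (hCov : ∀ t : ℝ, 0 ≤ t → t ≤ 1 → ∀ (B B' : PBond (F.P j) 0) (m m' : Fin 3 → ℝ) (V00 V10 V01 V11 : GaugeField (F.P j) 0 ↥(Matrix.specialUnitaryGroup (Fin 2) ℂ)),
      ‖m‖ ≤ rc * (θBal F.L γ b₀ p₀ j / 4) → ‖m'‖ ≤ rc * (θBal F.L γ b₀ p₀ j / 4) → PlaqSmall (θBal F.L γ b₀ p₀ j / 4) V00 → PlaqSmall (θBal F.L γ b₀ p₀ j / 4) V10 → PlaqSmall (θBal F.L γ b₀ p₀ j / 4) V01 → PlaqSmall (θBal F.L γ b₀ p₀ j / 4) V11 →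
      (∀ e, e ≠ B → V10 e = V00 e) → V10 B = V00 B * expPt m → (∀ e, e ≠ B' → V01 e = V00 e) → V01 B' = V00 B' * expPt m' →
      (∀ e, e ≠ B' → V11 e = V10 e) → V11 B' = V10 B' * expPt m' →
      ∀ (Y : ℝ → GaugeField (F.P j) 0 ↥(Matrix.specialUnitaryGroup (Fin 2) ℂ)) (X : ℝ → ℝ → GaugeField (F.P j) 0 ↥(Matrix.specialUnitaryGroup (Fin 2) ℂ)),
      (∀ s e, e ≠ B → Y s e = V00 e) → (∀ s, Y s B = V00 B * expPt (s • m)) → (∀ s s' e, e ≠ B' → X s s' e = Y s e) → (∀ s s', X s s' B' = Y s B' * expPt (s' • m')) →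
      ∀ s ∈ Set.Icc (0:ℝ) 1, ∀ (Pf Qf : Z → ℝ) (p q : ι → ℝ), Prof (X s 1) Pf p → Prof (X s 1) Qf q → ∀ (cP cQ : ℝ),
        cP = ∫ z, Pf z * (wNum F γ b₀ p₀ j Ts ρ ρ' Φ J t (X s 1) z / ∫ z', wNum F γ b₀ p₀ j Ts ρ ρ' Φ J t (X s 1) z' ∂τ) ∂τ → cQ = ∫ z, Qf z * (wNum F γ b₀ p₀ j Ts ρ ρ' Φ J t (X s 1) z / ∫ z', wNum F γ b₀ p₀ j Ts ρ ρ' Φ J t (X s 1) z' ∂τ) ∂τ →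
          Integrable (fun z => (Pf z - cP) * (Qf z - cQ) * (wNum F γ b₀ p₀ j Ts ρ ρ' Φ J t (X s 1) z / ∫ z', wNum F γ b₀ p₀ j Ts ρ ρ' Φ J t (X s 1) z' ∂τ)) τ ∧
            |∫ z, (Pf z - cP) * (Qf z - cQ) * (wNum F γ b₀ p₀ j Ts ρ ρ' Φ J t (X s 1) z / ∫ z', wNum F γ b₀ p₀ j Ts ρ ρ' Φ J t (X s 1) z' ∂τ) ∂τ| ≤ ∑ a, ∑ c, |p a| * 𝒢 a c * |q c|)
    -- (G₂-Δ^{prof}) the INCREMENT of the un-centred covariance of two FIXED profiled observables along the `B′`-edge `X s 0 → X s 1`; `Kh`-contracted edge mass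
    (𝒢Δ : ι → ι → PBond (F.P j) 0 → ℝ) (ωY : ι → PBond (F.P j) 0 → ℝ) (NΔ : ℝ) (hGΔ0 : ∀ a c B', 0 ≤ 𝒢Δ a c B') (hNΔ : 0 ≤ NΔ)
    (hGΔ : ∀ c, ∑ B', (∑ a, Kh a * 𝒢Δ a c B') * ωY c B' ≤ NΔ)
    (hIncr : ∀ t : ℝ, 0 ≤ t → t ≤ 1 → ∀ (B B' : PBond (F.P j) 0) (m m' : Fin 3 → ℝ) (V00 V10 V01 V11 : GaugeField (F.P j) 0 ↥(Matrix.specialUnitaryGroup (Fin 2) ℂ)),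
      ‖m‖ ≤ rc * (θBal F.L γ b₀ p₀ j / 4) → ‖m'‖ ≤ rc * (θBal F.L γ b₀ p₀ j / 4) → PlaqSmall (θBal F.L γ b₀ p₀ j / 4) V00 → PlaqSmall (θBal F.L γ b₀ p₀ j / 4) V10 → PlaqSmall (θBal F.L γ b₀ p₀ j / 4) V01 → PlaqSmall (θBal F.L γ b₀ p₀ j / 4) V11 →
      (∀ e, e ≠ B → V10 e = V00 e) → V10 B = V00 B * expPt m → (∀ e, e ≠ B' → V01 e = V00 e) → V01 B' = V00 B' * expPt m' →
      (∀ e, e ≠ B' → V11 e = V10 e) → V11 B' = V10 B' * expPt m' →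
      ∀ (Y : ℝ → GaugeField (F.P j) 0 ↥(Matrix.specialUnitaryGroup (Fin 2) ℂ)) (X : ℝ → ℝ → GaugeField (F.P j) 0 ↥(Matrix.specialUnitaryGroup (Fin 2) ℂ)),
      (∀ s e, e ≠ B → Y s e = V00 e) → (∀ s, Y s B = V00 B * expPt (s • m)) → (∀ s s' e, e ≠ B' → X s s' e = Y s e) → (∀ s s', X s s' B' = Y s B' * expPt (s' • m')) →
      ∀ s ∈ Set.Icc (0:ℝ) 1, ∀ (Pf Qf : Z → ℝ) (p q : ι → ℝ), Prof (X s 0) Pf p → Prof (X s 0) Qf q →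
        |((∫ z, Pf z * Qf z * (wNum F γ b₀ p₀ j Ts ρ ρ' Φ J t (X s 1) z / ∫ z', wNum F γ b₀ p₀ j Ts ρ ρ' Φ J t (X s 1) z' ∂τ) ∂τ) - (∫ z, Pf z * (wNum F γ b₀ p₀ j Ts ρ ρ' Φ J t (X s 1) z / ∫ z', wNum F γ b₀ p₀ j Ts ρ ρ' Φ J t (X s 1) z' ∂τ) ∂τ) * (∫ z, Qf z * (wNum F γ b₀ p₀ j Ts ρ ρ' Φ J t (X s 1) z / ∫ z', wNum F γ b₀ p₀ j Ts ρ ρ' Φ J t (X s 1) z' ∂τ) ∂τ))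
            - ((∫ z, Pf z * Qf z * (wNum F γ b₀ p₀ j Ts ρ ρ' Φ J t (X s 0) z / ∫ z', wNum F γ b₀ p₀ j Ts ρ ρ' Φ J t (X s 0) z' ∂τ) ∂τ) - (∫ z, Pf z * (wNum F γ b₀ p₀ j Ts ρ ρ' Φ J t (X s 0) z / ∫ z', wNum F γ b₀ p₀ j Ts ρ ρ' Φ J t (X s 0) z' ∂τ) ∂τ) * (∫ z, Qf z * (wNum F γ b₀ p₀ j Ts ρ ρ' Φ J t (X s 0) z / ∫ z', wNum F γ b₀ p₀ j Ts ρ ρ' Φ J t (X s 0) z' ∂τ) ∂τ))|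
          ≤ ‖m'‖ / (θBal F.L γ b₀ p₀ j / 4) * ∑ a, ∑ c, |p a| * 𝒢Δ a c B' * |q c|)
    -- (SC-PROF-L) ∕ (SC-Δ-PROF): profiles of the score on the near path and of the MIXED score increment; masses
    (Q₁ : ι → PBond (F.P j) 0 → ℝ) (Q₂ : ι → PBond (F.P j) 0 → PBond (F.P j) 0 → ℝ) (ωX : ι → PBond (F.P j) 0 → ℝ) (Nrow N₂ : ℝ)
    (hQ10 : ∀ c B, 0 ≤ Q₁ c B) (hQ20 : ∀ c B B', 0 ≤ Q₂ c B B') (hωX : ∀ c B, 0 ≤ ωX c B)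
    (hQcol : ∀ B, ∑ c, Q₁ c B * ωX c B ≤ Nrow) (hQ2 : ∀ B, ∑ c, ∑ B', Q₂ c B B' * Real.exp (κ * (B.src.tdist B'.src : ℝ)) ≤ N₂)
    (htri : ∀ (B B' : PBond (F.P j) 0) (c : ι), Real.exp (κ * (B.src.tdist B'.src : ℝ)) ≤ ωX c B * ωY c B')
    -- (h-PROF) ∧ (SC-PROF-L) ∧ (SC-Δ-PROF) at the square law points
    (hProfF : ∀ t : ℝ, 0 ≤ t → t ≤ 1 → ∀ (B B' : PBond (F.P j) 0) (m m' : Fin 3 → ℝ) (V00 V10 V01 V11 : GaugeField (F.P j) 0 ↥(Matrix.specialUnitaryGroup (Fin 2) ℂ)),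
      ‖m‖ ≤ rc * (θBal F.L γ b₀ p₀ j / 4) → ‖m'‖ ≤ rc * (θBal F.L γ b₀ p₀ j / 4) → PlaqSmall (θBal F.L γ b₀ p₀ j / 4) V00 → PlaqSmall (θBal F.L γ b₀ p₀ j / 4) V10 → PlaqSmall (θBal F.L γ b₀ p₀ j / 4) V01 → PlaqSmall (θBal F.L γ b₀ p₀ j / 4) V11 →
      (∀ e, e ≠ B → V10 e = V00 e) → V10 B = V00 B * expPt m → (∀ e, e ≠ B' → V01 e = V00 e) → V01 B' = V00 B' * expPt m' →
      (∀ e, e ≠ B' → V11 e = V10 e) → V11 B' = V10 B' * expPt m' →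
      ∀ (Y : ℝ → GaugeField (F.P j) 0 ↥(Matrix.specialUnitaryGroup (Fin 2) ℂ)) (X : ℝ → ℝ → GaugeField (F.P j) 0 ↥(Matrix.specialUnitaryGroup (Fin 2) ℂ)),
      (∀ s e, e ≠ B → Y s e = V00 e) → (∀ s, Y s B = V00 B * expPt (s • m)) → (∀ s s' e, e ≠ B' → X s s' e = Y s e) → (∀ s s', X s s' B' = Y s B' * expPt (s' • m')) →
      ∀ s ∈ Set.Icc (0:ℝ) 1,
        Prof (X s 1) (fun z => (Real.log (ρ Ts (Φ (V00, z))) - Real.log (ρ' Ts (Φ (V00, z))))) Kh ∧ Prof (X s 0) (fun z => (Real.log (ρ Ts (Φ (V00, z))) - Real.log (ρ' Ts (Φ (V00, z))))) Kh ∧ Prof (X s 0) (fun z => deriv (fun s => wNum F γ b₀ p₀ j Ts ρ ρ' Φ J t (X s 0) z) s / wNum F γ b₀ p₀ j Ts ρ ρ' Φ J t (X s 0) z) (fun a => ‖m‖ / (θBal F.L γ b₀ p₀ j / 4) * Q₁ a B) ∧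
          Prof (X s 1) (fun z => (deriv (fun s => wNum F γ b₀ p₀ j Ts ρ ρ' Φ J t (X s 1) z) s / wNum F γ b₀ p₀ j Ts ρ ρ' Φ J t (X s 1) z) - (deriv (fun s => wNum F γ b₀ p₀ j Ts ρ ρ' Φ J t (X s 0) z) s / wNum F γ b₀ p₀ j Ts ρ ρ' Φ J t (X s 0) z)) (fun a => ‖m‖ / (θBal F.L γ b₀ p₀ j / 4) * (‖m'‖ / (θBal F.L γ b₀ p₀ j / 4)) * Q₂ a B B'))
    -- the law facts at the far corner-path law points, a.e. in the path parameter
    (hlaw : ∀ t : ℝ, 0 ≤ t → t ≤ 1 → ∀ (B B' : PBond (F.P j) 0) (m m' : Fin 3 → ℝ) (V00 V10 V01 V11 : GaugeField (F.P j) 0 ↥(Matrix.specialUnitaryGroup (Fin 2) ℂ)),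
      ‖m‖ ≤ rc * (θBal F.L γ b₀ p₀ j / 4) → ‖m'‖ ≤ rc * (θBal F.L γ b₀ p₀ j / 4) → PlaqSmall (θBal F.L γ b₀ p₀ j / 4) V00 → PlaqSmall (θBal F.L γ b₀ p₀ j / 4) V10 → PlaqSmall (θBal F.L γ b₀ p₀ j / 4) V01 → PlaqSmall (θBal F.L γ b₀ p₀ j / 4) V11 →
      (∀ e, e ≠ B → V10 e = V00 e) → V10 B = V00 B * expPt m → (∀ e, e ≠ B' → V01 e = V00 e) → V01 B' = V00 B' * expPt m' →
      (∀ e, e ≠ B' → V11 e = V10 e) → V11 B' = V10 B' * expPt m' →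
      ∀ (Y : ℝ → GaugeField (F.P j) 0 ↥(Matrix.specialUnitaryGroup (Fin 2) ℂ)) (X : ℝ → ℝ → GaugeField (F.P j) 0 ↥(Matrix.specialUnitaryGroup (Fin 2) ℂ)),
      (∀ s e, e ≠ B → Y s e = V00 e) → (∀ s, Y s B = V00 B * expPt (s • m)) → (∀ s s' e, e ≠ B' → X s s' e = Y s e) → (∀ s s', X s s' B' = Y s B' * expPt (s' • m')) →
      ∀ᵐ s ∂(volume : Measure ℝ), s ∈ Set.Icc (0:ℝ) 1 →
        Integrable (fun z => (wNum F γ b₀ p₀ j Ts ρ ρ' Φ J t (X s 1) z / ∫ z', wNum F γ b₀ p₀ j Ts ρ ρ' Φ J t (X s 1) z' ∂τ)) τ ∧ ∫ z, (wNum F γ b₀ p₀ j Ts ρ ρ' Φ J t (X s 1) z / ∫ z', wNum F γ b₀ p₀ j Ts ρ ρ' Φ J t (X s 1) z' ∂τ) ∂τ = 1 ∧ Integrable (fun z => (Real.log (ρ Ts (Φ (V00, z))) - Real.log (ρ' Ts (Φ (V00, z)))) * (wNum F γ b₀ p₀ j Ts ρ ρ' Φ J t (X s 1) z / ∫ z',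 wNum F γ b₀ p₀ j Ts ρ ρ' Φ J t (X s 1) z' ∂τ)) τ ∧
        Integrable (fun z => (deriv (fun s => wNum F γ b₀ p₀ j Ts ρ ρ' Φ J t (X s 1) z) s / wNum F γ b₀ p₀ j Ts ρ ρ' Φ J t (X s 1) z) * (wNum F γ b₀ p₀ j Ts ρ ρ' Φ J t (X s 1) z / ∫ z', wNum F γ b₀ p₀ j Ts ρ ρ' Φ J t (X s 1) z' ∂τ)) τ ∧ Integrable (fun z => (deriv (fun s => wNum F γ b₀ p₀ j Ts ρ ρ' Φ J t (X s 0) z) s / wNum F γ b₀ p₀ j Ts ρ ρ' Φ J t (X s 0) z) * (wNum F γ b₀ p₀ j Ts ρ ρ' Φ J t (X s 1) z / ∫ z', wNum F γ b₀ p₀ j Ts ρ ρ' Φ J t (X s 1) z' ∂τ)) τ ∧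
        Integrable (fun z => (Real.log (ρ Ts (Φ (V00, z))) - Real.log (ρ' Ts (Φ (V00, z)))) * (deriv (fun s => wNum F γ b₀ p₀ j Ts ρ ρ' Φ J t (X s 1) z) s / wNum F γ b₀ p₀ j Ts ρ ρ' Φ J t (X s 1) z) * (wNum F γ b₀ p₀ j Ts ρ ρ' Φ J t (X s 1) z / ∫ z', wNum F γ b₀ p₀ j Ts ρ ρ' Φ J t (X s 1) z' ∂τ)) τ ∧
        Integrable (fun z => (Real.log (ρ Ts (Φ (V00, z))) - Real.log (ρ' Ts (Φ (V00, z)))) * (deriv (fun s => wNum F γ b₀ p₀ j Ts ρ ρ' Φ J t (X s 0) z) s / wNum F γ b₀ p₀ j Ts ρ ρ' Φ J t (X s 0) z) * (wNum F γ b₀ p₀ j Ts ρ ρ' Φ J t (X s 1) z / ∫ z', wNum F γ b₀ p₀ j Ts ρ ρ' Φ J t (X s 1) z' ∂τ)) τ)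
    (hM : NGh * N₂ + NΔ * Nrow ≤ M) :
    ∃ kL : PBond (F.P j) 0 → PBond (F.P j) 0 → ℝ, (∀ B B', 0 ≤ kL B B') ∧
      (∀ B, ∑ B', kL B B' * Real.exp (κ * (B.src.tdist B'.src : ℝ)) ≤ M) ∧
      ∀ t : ℝ, 0 ≤ t → t ≤ 1 → ∀ (B B' : PBond (F.P j) 0) (m m' : Fin 3 → ℝ) (V00 V10 V01 V11 : GaugeField (F.P j) 0 ↥(Matrix.specialUnitaryGroup (Fin 2) ℂ)),
        ‖m‖ ≤ rc * (θBal F.L γ b₀ p₀ j / 4) → ‖m'‖ ≤ rc * (θBal F.L γ b₀ p₀ j / 4) → PlaqSmall (θBal F.L γ b₀ p₀ j / 4) V00 → PlaqSmall (θBal F.L γ b₀ p₀ j / 4) V10 → PlaqSmall (θBal F.L γ b₀ p₀ j / 4) V01 → PlaqSmall (θBal F.L γ b₀ p₀ j / 4) V11 →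
        (∀ e, e ≠ B → V10 e = V00 e) → V10 B = V00 B * expPt m → (∀ e, e ≠ B' → V01 e = V00 e) → V01 B' = V00 B' * expPt m' →
        (∀ e, e ≠ B' → V11 e = V10 e) → V11 B' = V10 B' * expPt m' →
        ∀ (Y : ℝ → GaugeField (F.P j) 0 ↥(Matrix.specialUnitaryGroup (Fin 2) ℂ)) (X : ℝ → ℝ → GaugeField (F.P j) 0 ↥(Matrix.specialUnitaryGroup (Fin 2) ℂ)),
        (∀ s e, e ≠ B → Y s e = V00 e) → (∀ s, Y s B = V00 B * expPt (s • m)) → (∀ s s' e, e ≠ B' → X s s' e = Y s e) → (∀ s s', X s s' B' = Y s B' * expPt (s' • m')) →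
        (∀ᵐ s ∂(volume : Measure ℝ), s ∈ Set.Icc (0:ℝ) 1 → |((∫ z, (Real.log (ρ Ts (Φ (V00, z))) - Real.log (ρ' Ts (Φ (V00, z)))) * (deriv (fun s => wNum F γ b₀ p₀ j Ts ρ ρ' Φ J t (X s 1) z) s / wNum F γ b₀ p₀ j Ts ρ ρ' Φ J t (X s 1) z) * (wNum F γ b₀ p₀ j Ts ρ ρ' Φ J t (X s 1) z / ∫ z', wNum F γ b₀ p₀ j Ts ρ ρ' Φ J t (X s 1) z' ∂τ) ∂τ)
                  - (∫ z, (Real.log (ρ Ts (Φ (V00, z))) - Real.log (ρ' Ts (Φ (V00, z)))) * (wNum F γ b₀ p₀ j Ts ρ ρ' Φ J t (X s 1) z / ∫ z', wNum F γ b₀ p₀ j Ts ρ ρ' Φ J t (X s 1) z' ∂τ) ∂τ) * (∫ z, (deriv (fun s => wNum F γ b₀ p₀ j Ts ρ ρ' Φ J t (X s 1) z) s / wNum F γ b₀ p₀ j Ts ρ ρ' Φ J t (X s 1) z) * (wNum F γ b₀ p₀ j Ts ρ ρ' Φ J t (X s 1) z / ∫ z', wNum F γ b₀ p₀ j Ts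 ρ ρ' Φ J t (X s 1) z' ∂τ) ∂τ))
                - ((∫ z, (Real.log (ρ Ts (Φ (V00, z))) - Real.log (ρ' Ts (Φ (V00, z)))) * (deriv (fun s => wNum F γ b₀ p₀ j Ts ρ ρ' Φ J t (X s 0) z) s / wNum F γ b₀ p₀ j Ts ρ ρ' Φ J t (X s 0) z) * (wNum F γ b₀ p₀ j Ts ρ ρ' Φ J t (X s 0) z / ∫ z', wNum F γ b₀ p₀ j Ts ρ ρ' Φ J t (X s 0) z' ∂τ) ∂τ)
                  - (∫ z, (Real.log (ρ Ts (Φ (V00, z))) - Real.log (ρ' Ts (Φ (V00, z)))) * (wNum F γ b₀ p₀ j Ts ρ ρ' Φ J t (X s 0) z / ∫ z', wNum F γ b₀ p₀ j Ts ρ ρ' Φ J t (X s 0) z' ∂τ) ∂τ) * (∫ z, (deriv (fun s => wNum F γ b₀ p₀ j Ts ρ ρ' Φ J t (X s 0) z) s / wNum F γ b₀ p₀ j Ts ρ ρ' Φ J t (X s 0) z) * (wNum F γ b₀ p₀ j Ts ρ ρ' Φ J t (X s 0) z / ∫ z', wNum F γ b₀ p₀ j Ts ρ ρ' Φ J t (X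 s 0) z' ∂τ) ∂τ))| ≤ kL B B' * (‖m‖ / (θBal F.L γ b₀ p₀ j / 4)) * (‖m'‖ / (θBal F.L γ b₀ p₀ j / 4))) := by
  exact kerLClause_of_covKernel_increment_profiles τ
    (fun V z => Real.log (ρ Ts (Φ (V, z))) - Real.log (ρ' Ts (Φ (V, z))))
    (fun t Xw z => wNum F γ b₀ p₀ j Ts ρ ρ' Φ J t Xw z / ∫ z', wNum F γ b₀ p₀ j Ts ρ ρ' Φ J t Xw z' ∂τ)
    (fun t X' s z => deriv (fun s => wNum F γ b₀ p₀ j Ts ρ ρ' Φ J t (X' s) z) s / wNum F γ b₀ p₀ j Ts ρ ρ' Φ J t (X' s) z)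
    (θBal F.L γ b₀ p₀ j / 4) rc κ M (by positivity) Prof 𝒢 Kh NGh hG0 hKh0 hNGh hGh hCov 𝒢Δ ωY NΔ hGΔ0 hNΔ hGΔ hIncr Q₁ Q₂ ωX Nrow N₂ hQ10 hQ20 hωX
    hQcol hQ2 htri hProfF hlaw hM

end Organ

end Summit.QuantumFields.YangMills.Theorems.OrganTangentILawKerLOfScoreProfile

end
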